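import Summits.HodgeConjecture.HodgeConjecture.Theorems.F0P2pJacquetConstituentLemmas          -- ★ F0P2-p06 (g0) F2 p828054: `exists_evalOne_coinvariants`, `exists_mem_toFun_one_ne_zero_of_ne_bot` (+ ★ `jacquetMap_injective`)
import Literature.NumberTheory.Automorphic.Liu2021.LemD1AsPrinted                                 -- ★ `AreIsomorphicRep`
import HarnessLib

/-!
# Crux `H413`, programme P2 — road (T) «UP THE TOWER», step (4), GENERIC PART: a smooth `I` whose normalised Jacquet module is a NON-DEGENERATE two-step
# filtration (`χ′`-line, `χ`-quotient, `χ ≠ χ′`) carrying a Frobenius unit has at most ONE irreducible SUBrepresentation up to isomorphism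

Cell hodgecm-mathlib (D-0151), FLOOR 0, crux H413 = stmt-HodgeConjecture-24833; road (T) of the K1 lead B-p18 (g28) pays the U1 letter
★ `GelbartRogawski1991.u1ThetaDichotomy_nonsplit` through ★ `F0P2oU1LetterOfTower.u1ThetaDichotomy_nonsplit_of_uniqueSub (hN3) (h4)`; the binder `h4`
(SUB-UNIQUENESS for `i_G(χ)`, `χ ≠ wχ`, on `U(Φ₃)(L⁺_v)`) is the CM instance of THIS file's §2b at the booked N1 letter ★ `UnitaryGroup.U3PrincipalSeriesJacquetFiltration`
(filed separately, `Theorems/F0P2pPrincipalSeriesUniqueSubCM.lean`, so that the CM elaboration meets the generic theorem at ONE application).  THEOREMS ONLY (generic: any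
group `G`, any parabolic triple `t = (P, M, N)`); Lines-free; no named fact.  Companion of ★ `F0P2pPrincipalSeriesUniqueSub` (F0P2-p01 (g7): the eigenfunctional form
`equiv_of_eigenfunctionals`); here the hypotheses are the intertwining maps `Φᵢ` themselves and the conclusion is ★ `AreIsomorphicRep` — the shape of `h4`.

THE MATHEMATICS [Casselman1995 §6.3, Thm. 6.3.5 p. 59, Lemma 7.1.1 (a) p. 67; BernsteinZelevinsky1977 Prop. 1.9, Thm. 2.4 (b)].  Let `I` be a smooth representation of
`G` whose normalised Jacquet module `r_P I` is two-dimensional with an `M`-line `ℓ ≅ χ′` and quotient `χ`, `χ ≠ χ′`, and let `ev` be an `(M, χ)`-equivariant linear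
form on `r_P I` which does not vanish on the image of any non-zero subrepresentation (for `I = i_P^G(χ)` the unit of Frobenius reciprocity `f ↦ f(1)`:
★ `exists_evalOne_coinvariants`, ★ `exists_mem_toFun_one_ne_zero_of_ne_bot`); it kills `ℓ` (`χ ≠ χ′`).  If `Φᵢ : πᵢ → I` (`i = 1, 2`) are non-zero maps from
irreducibles, their images `W₁, W₂` are either EQUAL — then `π₁ ≅ W₁ = W₂ ≅ π₂` — or meet trivially; in the latter case `π₁ ⊕ π₂ ↪ I`, so by LEFT EXACTNESS of the
Jacquet functor (★ `jacquetMap_injective`: `N` a union of compact open subgroups, `I` smooth) the images `A, B ⊆ r_P I` of `r_P π₁, r_P π₂` are `M`-stable, meet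
trivially, and are not inside `ℓ`; two such submodules of a 2-dimensional space are complementary `χ`-lines, forcing `M` to act by `χ` on `ℓ` — contradiction
(§1, pure linear algebra).  §2 is the abstract theorem, §2b its principal-series form `I = i_P^G(χ)` (★ `Representation.normalizedInd`; Frobenius unit and smoothness
discharged, `δ_P|_N = 1` assumed) — the form whose hypotheses are, token for token, the conjuncts of the N1 letter and the binders of `h4`.
HC_CM is proved only modulo the printed citations until rung 0 closes; nothing here proves a letter.

## References
* [Casselman1995] W. Casselman, *Introduction to the theory of admissible representations of p-adic reductive groups* (1995): Prop. 3.2.3, Thm. 3.2.4,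
  §6.3 Thm. 6.3.5 p. 59, Lemma 7.1.1 (a) p. 67.
* [BernsteinZelevinsky1977] I. N. Bernstein, A. V. Zelevinsky, Ann. Sci. ÉNS 10 (1977): Prop. 1.9 (a)–(c), §2.3, Thm. 2.4 (b), Cor. 2.13 (c).
* [BernsteinZelevinsky1976] Russian Math. Surveys 31 (1976): Prop. 2.35.  [Rogawski1990] Ann. of Math. Stud. 123: §12.2 pp. 173–174.
-/

set_option autoImplicit false
-- the mandated namespace has the single-problem summit's repeated segment (`HodgeConjecture.HodgeConjecture`)
set_option linter.dupNamespace false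

noncomputable section

open Literature.NumberTheory Literature.NumberTheory.Automorphic Literature.NumberTheory.Automorphic.Liu2021

namespace Summit.HodgeConjecture.HodgeConjecture.Cruxes.H413.F0P2oPrincipalSeriesUniqueIrrSub

universe u

/-! ## §1 Linear algebra: a plane with a `χ′`-line and `χ`-quotient (`χ ≠ χ′`) has no two disjoint stable submodules off the line -/

/-- **Two disjoint stable submodules off the special line do not exist.**  Let `V` be a 2-dimensional `k`-space with operators `r m` (`m ∈ M`), a line `ℓ` on
which `r m = χ′ m`, and `r m x − χ m • x ∈ ℓ` for all `x` (so `M` acts by `χ` on `V ⁄ ℓ`), with `χ m₀ ≠ χ′ m₀` for some `m₀`.  If `A, B ≤ V` are `r`-stable,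
`A ⊓ B = ⊥`, and neither is contained in `ℓ`, then: both are lines meeting `ℓ` trivially, `r m = χ m` on each, `A ⊕ B = V`, hence `r m₀ = χ m₀` on `ℓ` —
contradiction. [cite: Casselman1995, §6.3 Thm. 6.3.5 p. 59] [cite: BernsteinZelevinsky1977, Thm. 2.4 (b)] -/
theorem false_of_two_disjoint_stable_submodules {k V M : Type*} [Field k] [AddCommGroup V] [Module k V] [FiniteDimensional k V]
    (h2 : Module.finrank k V = 2) (r : M → V →ₗ[k] V) (χ χ' : M → k) (hne : ∃ m, χ m ≠ χ' m)
    (ℓ : Submodule k V) (hℓ1 : Module.finrank k ℓ = 1) (hℓ : ∀ m, ∀ x ∈ ℓ, r m x = χ' m • x)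
    (hq : ∀ m x, r m x - χ m • x ∈ ℓ)
    (A B : Submodule k V) (hA : ∀ m, ∀ a ∈ A, r m a ∈ A) (hB : ∀ m, ∀ b ∈ B, r m b ∈ B) (hAB : A ⊓ B = ⊥)
    (hAℓ : ¬ A ≤ ℓ) (hBℓ : ¬ B ≤ ℓ) : False := by
  -- `A`, `B` are non-zero
  have hA0 : A ≠ ⊥ := fun h => hAℓ (h ▸ bot_le)
  have hB0 : B ≠ ⊥ := fun h => hBℓ (h ▸ bot_le)
  have hA1 : 1 ≤ Module.finrank k A := by
    rw [Nat.one_le_iff_ne_zero]; exact fun h => hA0 (Submodule.finrank_eq_zero.1 h)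
  have hB1 : 1 ≤ Module.finrank k B := by
    rw [Nat.one_le_iff_ne_zero]; exact fun h => hB0 (Submodule.finrank_eq_zero.1 h)
  -- `dim A + dim B = dim (A ⊔ B) ≤ 2`
  have hsum : Module.finrank k ↥(A ⊔ B) = Module.finrank k A + Module.finrank k B := by
    have h := Submodule.finrank_sup_add_finrank_inf_eq A B
    rw [hAB, finrank_bot, add_zero] at h
    exact h
  have hle2 : Module.finrank k ↥(A ⊔ B) ≤ 2 := h2 ▸ Submodule.finrank_le (A ⊔ B)
  have hAeq : Module.finrank k A = 1 := by omega
  have hBeq : Module.finrank k B = 1 := by omega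
  -- `A ⊔ B = V`
  have htop : A ⊔ B = ⊤ := Submodule.eq_top_of_finrank_eq (by rw [hsum, hAeq, hBeq, h2])
  -- a stable line not inside `ℓ` meets `ℓ` trivially, hence carries the character `χ`
  have key : ∀ C : Submodule k V, (∀ m, ∀ c ∈ C, r m c ∈ C) → ¬ C ≤ ℓ → Module.finrank k C = 1 →
      ∀ m, ∀ c ∈ C, r m c = χ m • c := by
    intro C hC hCℓ hC1 m c hc
    have hCℓ0 : C ⊓ ℓ = ⊥ := by
      by_contra hne0
      have h1 : 1 ≤ Module.finrank k ↥(C ⊓ ℓ) := by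
        rw [Nat.one_le_iff_ne_zero]; exact fun h => hne0 (Submodule.finrank_eq_zero.1 h)
      have heq : C ⊓ ℓ = C :=
        Submodule.eq_of_le_of_finrank_le inf_le_left (by rw [hC1]; exact h1)
      exact hCℓ (heq ▸ inf_le_right)
    have hmem : r m c - χ m • c ∈ C ⊓ ℓ := ⟨C.sub_mem (hC m c hc) (C.smul_mem _ hc), hq m c⟩
    rw [hCℓ0, Submodule.mem_bot, sub_eq_zero] at hmem
    exact hmem
  have hAχ := key A hA hAℓ hAeq
  have hBχ := key B hB hBℓ hBeq
  -- hence `r m = χ m` on all of `V`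
  have hall : ∀ m x, r m x = χ m • x := by
    intro m x
    have hx : x ∈ A ⊔ B := htop ▸ Submodule.mem_top
    obtain ⟨a, ha, b, hb, rfl⟩ := Submodule.mem_sup.1 hx
    rw [map_add, hAχ m a ha, hBχ m b hb, smul_add]
  -- but `ℓ` carries `χ′ ≠ χ`
  obtain ⟨m₀, hm₀⟩ := hne
  have hℓ0 : ℓ ≠ ⊥ := fun h => by
    rw [h, finrank_bot] at hℓ1
    exact zero_ne_one hℓ1
  obtain ⟨x₀, hx₀ℓ, hx₀⟩ := Submodule.exists_mem_ne_zero_of_ne_bot hℓ0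
  have h := hℓ m₀ x₀ hx₀ℓ
  rw [hall m₀ x₀] at h
  have h' : (χ m₀ - χ' m₀) • x₀ = 0 := by rw [sub_smul, h, sub_self]
  rcases smul_eq_zero.1 h' with h'' | h''
  · exact hm₀ (sub_eq_zero.1 h'')
  · exact hx₀ h''

/-! ## §2 The abstract theorem: a smooth `I` with a non-degenerate two-step Jacquet filtration and a Frobenius unit has a unique irreducible SUBrepresentation -/

section Abstract

variable {G : Type u} [Group G] [TopologicalSpace G] [IsTopologicalGroup G] (t : ParabolicTriple G) [LocallyCompactSpace t.P]

omit [TopologicalSpace G] [IsTopologicalGroup G] [LocallyCompactSpace t.P] in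
/-- `jacquetMap` of a composite, pointwise. [cite: BernsteinZelevinsky1977, §1.8] -/
theorem jacquetMap_comp_apply {V₁ V₂ V₃ : Type*} [AddCommGroup V₁] [Module ℂ V₁] [AddCommGroup V₂] [Module ℂ V₂] [AddCommGroup V₃] [Module ℂ V₃]
    {ρ₁ : Representation ℂ G V₁} {ρ₂ : Representation ℂ G V₂} {ρ₃ : Representation ℂ G V₃}
    (f : ρ₂.IntertwiningMap ρ₃) (g : ρ₁.IntertwiningMap ρ₂) (x : (t.restrict ρ₁).Coinvariants) :
    Representation.jacquetMap t (f.comp g) x = Representation.jacquetMap t f (Representation.jacquetMap t g x) := by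
  obtain ⟨v, rfl⟩ := Representation.Coinvariants.mk_surjective _ x
  rw [Representation.jacquetMap_mk, Representation.jacquetMap_mk, Representation.jacquetMap_mk, Representation.IntertwiningMap.comp_apply]

omit [TopologicalSpace G] [IsTopologicalGroup G] [LocallyCompactSpace t.P] in
/-- `jacquetMap` is additive in the intertwining map, pointwise. [cite: BernsteinZelevinsky1977, §1.8] -/
theorem jacquetMap_add_apply {V₁ V₂ : Type*} [AddCommGroup V₁] [Module ℂ V₁] [AddCommGroup V₂] [Module ℂ V₂]
    {ρ₁ : Representation ℂ G V₁} {ρ₂ : Representation ℂ G V₂} (f g : ρ₁.IntertwiningMap ρ₂) (x : (t.restrict ρ₁).Coinvariants) :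
    Representation.jacquetMap t (f + g) x = Representation.jacquetMap t f x + Representation.jacquetMap t g x := by
  obtain ⟨v, rfl⟩ := Representation.Coinvariants.mk_surjective _ x
  rw [Representation.jacquetMap_mk, Representation.jacquetMap_mk, Representation.jacquetMap_mk, ← map_add]
  rfl

/-- The normalised Jacquet action is a unit multiple of the plain one: `r_P(m) x = δ_P(m)^{-1/2} • (m • x)`. [cite: BernsteinZelevinsky1977, §2.3] -/
theorem normalizedJacquet_eq_smul_jacquetModule {V : Type*} [AddCommGroup V] [Module ℂ V] (ρ : Representation ℂ G V) (m : t.M)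
    (x : (t.restrict ρ).Coinvariants) :
    ρ.normalizedJacquet t m x = (((rootDeltaChar t.P (Subgroup.inclusion t.M_le m))⁻¹ : ℂˣ) : ℂ) • ρ.jacquetModule t m x := by
  obtain ⟨v, rfl⟩ := Representation.Coinvariants.mk_surjective _ x
  rw [Representation.normalizedJacquet_mk, Representation.jacquetModule_mk]

/-- The image of `r_P π` in `r_P I` along `r_P Φ` is stable under the NORMALISED Jacquet action of `M`. [cite: BernsteinZelevinsky1977, §1.8, §2.3] -/
theorem normalizedJacquet_mem_range_jacquetMap {VI V : Type*} [AddCommGroup VI] [Module ℂ VI] [AddCommGroup V] [Module ℂ V]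
    {I : Representation ℂ G VI} {π : Representation ℂ G V} (Φ : π.IntertwiningMap I) (m : t.M)
    {a : (t.restrict I).Coinvariants} (ha : a ∈ LinearMap.range (Representation.jacquetMap t Φ).toLinearMap) :
    I.normalizedJacquet t m a ∈ LinearMap.range (Representation.jacquetMap t Φ).toLinearMap := by
  obtain ⟨y, rfl⟩ := ha
  rw [normalizedJacquet_eq_smul_jacquetModule]
  refine Submodule.smul_mem _ _ ⟨π.jacquetModule t m y, ?_⟩
  rw [Representation.IntertwiningMap.toLinearMap_apply, Representation.IntertwiningMap.toLinearMap_apply]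
  exact (Representation.jacquetMap t Φ).isIntertwining _ _ m y

omit [TopologicalSpace G] [IsTopologicalGroup G] [LocallyCompactSpace t.P] in
/-- If a linear form `ev` on `r_P I` kills `ℓ` but not the image of any non-zero subrepresentation of `I`, then for a NON-ZERO `Φ : π → I` the image of
`r_P π` in `r_P I` is not inside `ℓ` (the Frobenius unit sees `Φ.range ≠ ⊥`). [cite: BernsteinZelevinsky1977, Prop. 1.9 (b)–(c)] -/
theorem not_range_jacquetMap_le {VI : Type*} [AddCommGroup VI] [Module ℂ VI] {I : Representation ℂ G VI}
    (ev : (t.restrict I).Coinvariants →ₗ[ℂ] ℂ) (ℓ : Submodule ℂ (t.restrict I).Coinvariants) (hevℓ : ∀ x ∈ ℓ, ev x = 0)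
    (hevW : ∀ W : Subrepresentation I, W ≠ ⊥ → ∃ w ∈ W, ev (Representation.Coinvariants.mk (t.restrict I) w) ≠ 0)
    {V : Type*} [AddCommGroup V] [Module ℂ V] {π : Representation ℂ G V} (Φ : π.IntertwiningMap I) (hΦ : Φ ≠ 0) :
    ¬ LinearMap.range (Representation.jacquetMap t Φ).toLinearMap ≤ ℓ := by
  intro hle
  have hR : Φ.range ≠ ⊥ := by
    intro h
    apply hΦ
    apply Representation.IntertwiningMap.ext
    apply LinearMap.ext
    intro v
    have hv : Φ v ∈ Φ.range := ⟨v, rfl⟩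
    rw [h] at hv
    exact (Submodule.mem_bot ℂ).1 hv
  obtain ⟨w, ⟨v, rfl⟩, hw⟩ := hevW Φ.range hR
  exact hw (hevℓ _ (hle ⟨Representation.Coinvariants.mk _ v, rfl⟩))

set_option maxHeartbeats 1600000 in
/-- **UNIQUE IRREDUCIBLE SUBREPRESENTATION from a non-degenerate two-step Jacquet filtration.**  Let `t = (P, M, N)` be a parabolic triple with `N` a union of
compact open subgroups, `I` a SMOOTH representation whose Jacquet module `r_P I` (normalised `M`-action) is 2-dimensional with an `M`-stable line `ℓ` of character
`χ′` and quotient character `χ`, `χ ≠ χ′`, and let `ev` be a `(M, χ)`-equivariant linear form on `r_P I` not vanishing on the image of any non-zero subrepresentation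
of `I` (the unit `f ↦ f(1)` of Frobenius reciprocity when `I = i_P^G(χ)`).  Then any two irreducible representations `π₁, π₂` admitting NON-ZERO intertwining maps
`Φᵢ : πᵢ → I` are isomorphic (★ `AreIsomorphicRep`).  Proof: the images are equal (then `π₁ ≅ W ≅ π₂`) or disjoint; if disjoint, `π₁ ⊕ π₂ ↪ I` and left exactness
(★ `jacquetMap_injective`) makes the images of `r_P π₁`, `r_P π₂` two disjoint `M`-stable submodules of `r_P I` off `ℓ` — impossible by §1.
[cite: Casselman1995, §6.3 Thm. 6.3.5 p. 59; Thm. 3.2.4] [cite: BernsteinZelevinsky1977, Prop. 1.9 (a)–(c); Thm. 2.4 (b)] [cite: BernsteinZelevinsky1976, Prop. 2.35] -/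
theorem areIsomorphicRep_of_intertwiningMap_ne_zero (hN : IsLimitOfCompactOpen t.N)
    {VI : Type*} [AddCommGroup VI] [Module ℂ VI] {I : Representation ℂ G VI} (hI : I.IsSmooth)
    (χ χ' : t.M →* ℂˣ) (hne : χ ≠ χ')
    (ev : (t.restrict I).Coinvariants →ₗ[ℂ] ℂ)
    (hev : ∀ (m : t.M) (x : (t.restrict I).Coinvariants), ev (I.normalizedJacquet t m x) = ((χ m : ℂˣ) : ℂ) * ev x)
    (hevW : ∀ W : Subrepresentation I, W ≠ ⊥ → ∃ w ∈ W, ev (Representation.Coinvariants.mk (t.restrict I) w) ≠ 0)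
    (hfd : FiniteDimensional ℂ (t.restrict I).Coinvariants) (h2 : Module.finrank ℂ (t.restrict I).Coinvariants = 2)
    (ℓ : Submodule ℂ (t.restrict I).Coinvariants) (hℓ1 : Module.finrank ℂ ℓ = 1)
    (hℓ : ∀ (m : t.M), ∀ x ∈ ℓ, I.normalizedJacquet t m x = ((χ' m : ℂˣ) : ℂ) • x)
    (hq : ∀ (m : t.M) (x : (t.restrict I).Coinvariants), I.normalizedJacquet t m x - ((χ m : ℂˣ) : ℂ) • x ∈ ℓ)
    {V₁ V₂ : Type*} [AddCommGroup V₁] [Module ℂ V₁] [AddCommGroup V₂] [Module ℂ V₂]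
    {π₁ : Representation ℂ G V₁} {π₂ : Representation ℂ G V₂} (hπ₁ : π₁.IsIrreducible) (hπ₂ : π₂.IsIrreducible)
    (Φ₁ : π₁.IntertwiningMap I) (Φ₂ : π₂.IntertwiningMap I) (hΦ₁ : Φ₁ ≠ 0) (hΦ₂ : Φ₂ ≠ 0) :
    AreIsomorphicRep π₁ π₂ := by
  classical
  haveI := hfd
  haveI := hπ₁
  haveI := hπ₂
  have hinj₁ : Function.Injective Φ₁ := (Representation.IsIrreducible.injective_or_eq_zero Φ₁).resolve_right hΦ₁
  have hinj₂ : Function.Injective Φ₂ := (Representation.IsIrreducible.injective_or_eq_zero Φ₂).resolve_right hΦ₂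
  by_cases hW : Φ₁.range = Φ₂.range
  · -- equal images: `π₁ ≅ W ≅ π₂`
    have hW' : LinearMap.range Φ₁.toLinearMap = LinearMap.range Φ₂.toLinearMap := congrArg Subrepresentation.toSubmodule hW
    let e₁ : V₁ ≃ₗ[ℂ] ↥(LinearMap.range Φ₁.toLinearMap) := LinearEquiv.ofInjective Φ₁.toLinearMap hinj₁
    let e₂ : V₂ ≃ₗ[ℂ] ↥(LinearMap.range Φ₂.toLinearMap) := LinearEquiv.ofInjective Φ₂.toLinearMap hinj₂
    let eW : ↥(LinearMap.range Φ₁.toLinearMap) ≃ₗ[ℂ] ↥(LinearMap.range Φ₂.toLinearMap) := LinearEquiv.ofEq _ _ hW'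
    -- `Φ₂ (e₂⁻¹ y) = y`
    have hΦ₂e : ∀ y : ↥(LinearMap.range Φ₂.toLinearMap), Φ₂ (e₂.symm y) = (y : VI) := fun y => by
      have h := LinearEquiv.apply_symm_apply e₂ y
      have h' := congrArg Subtype.val h
      rw [LinearEquiv.ofInjective_apply] at h'
      exact h'
    -- `Φ₂ ∘ f = Φ₁` for `f := e₂⁻¹ ∘ eW ∘ e₁`
    have hf : ∀ x : V₁, Φ₂ ((e₁.trans (eW.trans e₂.symm)) x) = Φ₁ x := fun x => by
      rw [LinearEquiv.trans_apply, LinearEquiv.trans_apply, hΦ₂e, LinearEquiv.coe_ofEq_apply, LinearEquiv.ofInjective_apply]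
      rfl
    refine ⟨e₁.trans (eW.trans e₂.symm), fun g v => ?_⟩
    apply hinj₂
    rw [Φ₂.isIntertwining _ _ g, hf, hf, Φ₁.isIntertwining _ _ g]
  · -- distinct images are disjoint
    have hdisj : Φ₁.range ⊓ Φ₂.range = ⊥ := by
      -- the pull-back of `W₁` along `Φ₂` is a subrepresentation of the irreducible `π₂`
      let K₂ : Subrepresentation π₂ :=
        ⟨(Φ₁.range).toSubmodule.comap Φ₂.toLinearMap, fun g x hx => by
          change Φ₂ (π₂ g x) ∈ Φ₁.range
          rw [Φ₂.isIntertwining _ _ g x]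
          exact (Φ₁.range).apply_mem_toSubmodule g hx⟩
      let K₁ : Subrepresentation π₁ :=
        ⟨(Φ₂.range).toSubmodule.comap Φ₁.toLinearMap, fun g x hx => by
          change Φ₁ (π₁ g x) ∈ Φ₂.range
          rw [Φ₁.isIntertwining _ _ g x]
          exact (Φ₂.range).apply_mem_toSubmodule g hx⟩
      have aux₂ : K₂ = ⊥ → Φ₁.range ⊓ Φ₂.range = ⊥ := by
        intro hK
        apply Subrepresentation.toSubmodule_injective
        rw [Subrepresentation.toSubmodule_inf]
        change _ = (⊥ : Submodule ℂ VI)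
        rw [Submodule.eq_bot_iff]
        rintro y ⟨hy₁, ⟨x, rfl⟩⟩
        have hx : x ∈ K₂ := hy₁
        rw [hK] at hx
        have hx0 : x = 0 := (Submodule.mem_bot ℂ).1 hx
        rw [hx0]
        exact map_zero _
      have aux₁ : K₁ = ⊥ → Φ₁.range ⊓ Φ₂.range = ⊥ := by
        intro hK
        apply Subrepresentation.toSubmodule_injective
        rw [Subrepresentation.toSubmodule_inf]
        change _ = (⊥ : Submodule ℂ VI)
        rw [Submodule.eq_bot_iff]
        rintro y ⟨⟨x, rfl⟩, hy₂⟩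
        have hx : x ∈ K₁ := hy₂
        rw [hK] at hx
        have hx0 : x = 0 := (Submodule.mem_bot ℂ).1 hx
        rw [hx0]
        exact map_zero _
      rcases IsSimpleOrder.eq_bot_or_eq_top K₂ with hK₂ | hK₂
      · exact aux₂ hK₂
      rcases IsSimpleOrder.eq_bot_or_eq_top K₁ with hK₁ | hK₁
      · exact aux₁ hK₁
      -- both pull-backs are everything: `W₂ ≤ W₁` and `W₁ ≤ W₂`
      exfalso
      apply hW
      apply le_antisymm
      · rintro y ⟨x, rfl⟩
        have hx : x ∈ K₁ := by rw [hK₁]; trivial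
        exact hx
      · rintro y ⟨x, rfl⟩
        have hx : x ∈ K₂ := by rw [hK₂]; trivial
        exact hx
    -- `π₁ ⊕ π₂ ↪ I`
    let s : (π₁.prod π₂).IntertwiningMap I :=
      Φ₁.comp (Representation.IntertwiningMap.fst ℂ π₁ π₂) + Φ₂.comp (Representation.IntertwiningMap.snd ℂ π₁ π₂)
    have hs_apply : ∀ p : V₁ × V₂, s p = Φ₁ p.1 + Φ₂ p.2 := fun p => rfl
    have hs : Function.Injective s := by
      rw [injective_iff_map_eq_zero]
      rintro ⟨a, b⟩ hab
      rw [hs_apply] at hab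
      have ha : Φ₁ a ∈ Φ₁.range ⊓ Φ₂.range := by
        refine ⟨⟨a, rfl⟩, ⟨-b, ?_⟩⟩
        rw [map_neg, neg_eq_iff_add_eq_zero, add_comm]
        exact hab
      rw [hdisj] at ha
      have ha0 : Φ₁ a = 0 := (Submodule.mem_bot ℂ).1 ha
      have hb0 : Φ₂ b = 0 := by rwa [ha0, zero_add] at hab
      have ha' : a = 0 := hinj₁ (by rw [ha0, map_zero])
      have hb' : b = 0 := hinj₂ (by rw [hb0, map_zero])
      rw [ha', hb']
      rfl
    have hsJ : Function.Injective (Representation.jacquetMap t s) := Representation.jacquetMap_injective t hN hI s hs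
    -- the two images in `r_P I`
    let A : Submodule ℂ (t.restrict I).Coinvariants := LinearMap.range (Representation.jacquetMap t Φ₁).toLinearMap
    let B : Submodule ℂ (t.restrict I).Coinvariants := LinearMap.range (Representation.jacquetMap t Φ₂).toLinearMap
    -- `r Φ₁ = r s ∘ r inl`, `r Φ₂ = r s ∘ r inr`, `r fst ∘ r inl = id`, `r fst ∘ r inr = 0`
    have h1 : ∀ y, Representation.jacquetMap t s (Representation.jacquetMap t (Representation.IntertwiningMap.inl ℂ π₁ π₂) y) =
        Representation.jacquetMap t Φ₁ y := fun y => by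
      obtain ⟨v, rfl⟩ := Representation.Coinvariants.mk_surjective _ y
      rw [Representation.jacquetMap_mk, Representation.jacquetMap_mk, Representation.jacquetMap_mk, hs_apply]
      change Representation.Coinvariants.mk (t.restrict I) (Φ₁ v + Φ₂ 0) = _
      rw [map_zero, add_zero]
    have h2' : ∀ y, Representation.jacquetMap t s (Representation.jacquetMap t (Representation.IntertwiningMap.inr ℂ π₁ π₂) y) =
        Representation.jacquetMap t Φ₂ y := fun y => by
      obtain ⟨v, rfl⟩ := Representation.Coinvariants.mk_surjective _ y
      rw [Representation.jacquetMap_mk, Representation.jacquetMap_mk, Representation.jacquetMap_mk, hs_apply]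
      change Representation.Coinvariants.mk (t.restrict I) (Φ₁ 0 + Φ₂ v) = _
      rw [map_zero, zero_add]
    have h3 : ∀ y, Representation.jacquetMap t (Representation.IntertwiningMap.fst ℂ π₁ π₂)
        (Representation.jacquetMap t (Representation.IntertwiningMap.inl ℂ π₁ π₂) y) = y := fun y => by
      obtain ⟨v, rfl⟩ := Representation.Coinvariants.mk_surjective _ y
      rw [Representation.jacquetMap_mk, Representation.jacquetMap_mk]
      rfl
    have h4 : ∀ y, Representation.jacquetMap t (Representation.IntertwiningMap.fst ℂ π₁ π₂)
        (Representation.jacquetMap t (Representation.IntertwiningMap.inr ℂ π₁ π₂) y) = 0 := fun y => by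
      obtain ⟨v, rfl⟩ := Representation.Coinvariants.mk_surjective _ y
      rw [Representation.jacquetMap_mk, Representation.jacquetMap_mk]
      change Representation.Coinvariants.mk (t.restrict π₁) 0 = 0
      rw [map_zero]
    have hAB : A ⊓ B = ⊥ := by
      rw [Submodule.eq_bot_iff]
      rintro x ⟨⟨y₁, rfl⟩, ⟨y₂, hy⟩⟩
      rw [Representation.IntertwiningMap.toLinearMap_apply, Representation.IntertwiningMap.toLinearMap_apply, ← h1, ← h2'] at hy
      have hy' := hsJ hy
      have hy₁ : y₁ = 0 := by rw [← h3 y₁, ← hy', h4]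
      rw [Representation.IntertwiningMap.toLinearMap_apply, hy₁, map_zero]
    -- `ev` kills `ℓ` (`χ ≠ χ′`)
    obtain ⟨m₀, hm₀⟩ : ∃ m, χ m ≠ χ' m := by
      by_contra h
      exact hne (MonoidHom.ext fun m => not_not.1 (not_exists.1 h m))
    have hm₀' : ((χ m₀ : ℂˣ) : ℂ) ≠ ((χ' m₀ : ℂˣ) : ℂ) := fun h => hm₀ (Units.ext h)
    have hevℓ : ∀ x ∈ ℓ, ev x = 0 := by
      intro x hx
      have h := hev m₀ x
      rw [hℓ m₀ x hx, map_smul, smul_eq_mul] at h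
      have h' : (((χ' m₀ : ℂˣ) : ℂ) - ((χ m₀ : ℂˣ) : ℂ)) * ev x = 0 := by rw [sub_mul, h, sub_self]
      rcases mul_eq_zero.1 h' with h'' | h''
      · exact absurd (sub_eq_zero.1 h'').symm hm₀'
      · exact h''
    -- `A`, `B` are not inside `ℓ` (Frobenius unit)
    have hAℓ := not_range_jacquetMap_le t ev ℓ hevℓ hevW Φ₁ hΦ₁
    have hBℓ := not_range_jacquetMap_le t ev ℓ hevℓ hevW Φ₂ hΦ₂
    exact (false_of_two_disjoint_stable_submodules h2 (fun m => (I.normalizedJacquet t m : _ →ₗ[ℂ] _))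
      (fun m => ((χ m : ℂˣ) : ℂ)) (fun m => ((χ' m : ℂˣ) : ℂ)) ⟨m₀, hm₀'⟩ ℓ hℓ1 hℓ hq A B
      (fun m a ha => normalizedJacquet_mem_range_jacquetMap t Φ₁ m ha) (fun m b hb => normalizedJacquet_mem_range_jacquetMap t Φ₂ m hb)
      hAB hAℓ hBℓ).elim

end Abstract

/-! ## §2b The principal-series form: `I = i_P^G(χ)` (★ `Representation.normalizedInd`), Frobenius unit and smoothness discharged -/

section NormalizedInd

variable {G : Type u} [Group G] [TopologicalSpace G] [IsTopologicalGroup G] (t : ParabolicTriple G) [LocallyCompactSpace t.P]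

set_option maxHeartbeats 1600000 in
/-- **SUB-UNIQUENESS FOR `i_P^G(χ)`, `χ ≠ χ′` (generic).**  Let `t = (P, M, N)` be a parabolic triple with `N` a union of compact open subgroups and `δ_P|_N = 1`, and
`χ, χ′ : M → ℂˣ` with `χ ≠ χ′`.  Suppose the normalised Jacquet module `r_P i_P^G(χ)` is finite-dimensional of dimension `2`, with an `M`-stable line `ℓ` on which `M`
acts through `χ′` and modulo which `M` acts through `χ` (for `U(3)`: [Casselman1995, Lemma 7.1.1 (a)], the N1 letter).  Then any two IRREDUCIBLE representations `π₁, π₂`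
of `G` admitting NON-ZERO intertwining maps `Φᵢ : πᵢ → i_P^G(χ)` are isomorphic (★ `AreIsomorphicRep`): §2 with the Frobenius unit `f ↦ f(1)` (★
`exists_evalOne_coinvariants`, `(M, χ)`-equivariant; non-zero on non-zero subrepresentations, ★ `exists_mem_toFun_one_ne_zero_of_ne_bot`) and `i_P^G(χ)` smooth (★
`Representation.isSmooth_smoothInd`).  The hypotheses are, token for token, the conjuncts of ★ `UnitaryGroup.U3PrincipalSeriesJacquetFiltration` and the binders of the
road-(T) binder `h4` at `t = cmBorelTriple L 3 v` (`cmPrincipalSeries L 3 v χ` unfolds to `normalizedInd (cmBorelTriple L 3 v) (𝟙 ⊗ χ)`).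
[cite: Casselman1995, Lemma 7.1.1 (a) p. 67; §6.3 Thm. 6.3.5 p. 59; Thm. 3.2.4] [cite: BernsteinZelevinsky1977, Prop. 1.9 (a)–(c); Thm. 2.4 (b)] -/
theorem areIsomorphicRep_of_intertwiningMap_normalizedInd_ne_zero (hN : IsLimitOfCompactOpen t.N)
    (χ χ' : t.M →* ℂˣ) (hne : χ ≠ χ')
    (hδ : ∀ (n : G) (hn : n ∈ t.N), deltaChar t.P ⟨n, t.N_le hn⟩ = 1)
    (hfd : FiniteDimensional ℂ (t.restrict (Representation.normalizedInd t ((Representation.trivial ℂ ↥t.M ℂ).twist χ))).Coinvariants)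
    (h2 : Module.finrank ℂ (t.restrict (Representation.normalizedInd t ((Representation.trivial ℂ ↥t.M ℂ).twist χ))).Coinvariants = 2)
    (ℓ : Submodule ℂ (t.restrict (Representation.normalizedInd t ((Representation.trivial ℂ ↥t.M ℂ).twist χ))).Coinvariants)
    (hℓ1 : Module.finrank ℂ ↥ℓ = 1)
    (hℓ : ∀ (m : ↥t.M), ∀ x ∈ ℓ,
      (Representation.normalizedInd t ((Representation.trivial ℂ ↥t.M ℂ).twist χ)).normalizedJacquet t m x = ((χ' m : ℂˣ) : ℂ) • x)
    (hq : ∀ (m : ↥t.M) (x : (t.restrict (Representation.normalizedInd t ((Representation.trivial ℂ ↥t.M ℂ).twist χ))).Coinvariants),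
      (Representation.normalizedInd t ((Representation.trivial ℂ ↥t.M ℂ).twist χ)).normalizedJacquet t m x - ((χ m : ℂˣ) : ℂ) • x ∈ ℓ)
    {V₁ V₂ : Type*} [AddCommGroup V₁] [Module ℂ V₁] [AddCommGroup V₂] [Module ℂ V₂]
    {π₁ : Representation ℂ G V₁} {π₂ : Representation ℂ G V₂} (hπ₁ : π₁.IsIrreducible) (hπ₂ : π₂.IsIrreducible)
    (Φ₁ : π₁.IntertwiningMap (Representation.normalizedInd t ((Representation.trivial ℂ ↥t.M ℂ).twist χ)))
    (Φ₂ : π₂.IntertwiningMap (Representation.normalizedInd t ((Representation.trivial ℂ ↥t.M ℂ).twist χ)))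
    (hΦ₁ : Φ₁ ≠ 0) (hΦ₂ : Φ₂ ≠ 0) :
    AreIsomorphicRep π₁ π₂ := by
  -- the Frobenius unit `f ↦ f(1)` on `r_P i_P^G(χ)` (★ F0P2-p06 F2), `(M, χ)`-equivariant, non-zero on non-zero subrepresentations
  obtain ⟨ev, hev1, hev⟩ := F0P2pJacquetConstituentLemmas.exists_evalOne_coinvariants t χ hδ
  have hevW : ∀ W : Subrepresentation (Representation.normalizedInd t ((Representation.trivial ℂ ↥t.M ℂ).twist χ)), W ≠ ⊥ →
      ∃ w ∈ W, ev (Representation.Coinvariants.mk _ w) ≠ 0 := by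
    intro W hW
    obtain ⟨f, hfW, hf⟩ := F0P2pJacquetConstituentLemmas.exists_mem_toFun_one_ne_zero_of_ne_bot t χ W hW
    exact ⟨f, hfW, fun h0 => hf ((hev1 f).symm.trans h0)⟩
  exact areIsomorphicRep_of_intertwiningMap_ne_zero t hN (Representation.isSmooth_smoothInd _ _) χ χ' hne ev hev hevW hfd h2 ℓ hℓ1 hℓ hq
    hπ₁ hπ₂ Φ₁ Φ₂ hΦ₁ hΦ₂

end NormalizedInd

end Summit.HodgeConjecture.HodgeConjecture.Cruxes.H413.F0P2oPrincipalSeriesUniqueIrrSub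

end
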